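import Literature.Claims.NS.Ruzmaikina2008
import Literature.Analysis.FluidPDE.NearBeltramiEnstrophyCriterion
import Literature.Analysis.FluidPDE.TaoEnstrophyLocalisationProofs
import Literature.Analysis.FluidPDE.AxisymNoSwirlTaoBounds
import Literature.Analysis.FluidPDE.LeiZhang2011Proofs
import Literature.Analysis.FluidPDE.LerayProfileCalculus
import Literature.Analysis.FluidPDE.EnergyUniqueness
import Literature.Analysis.FluidPDE.ConstantinFeffermanEnstrophySlab
import Literature.Analysis.FluidPDE.ClassicalNSGlobalOfEnstrophyBound
import Mathlib.Analysis.Calculus.Deriv.MeanValue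
import HarnessLib

/-!
# Claim skeleton: Lindgren (2012/2014), «Navier-Stokes regularity in 3D» (arXiv:1207.1090 v3)

Cell `ns-claims` (D-0090 NS-CLAIMS SWEEP), claim C32, typist `ns-claims-typist-9` (g2; lead redirect
2026-08-26T23:04:46Z). UNREFEREED/DISPUTED CLAIM under adjudication — NOTHING in this file asserts a
step: every `Step…` declaration is a `Prop` (one printed assertion or asserted implication, typed concretely
so that its negation or its vacuity can be a kernel theorem in
`Summits/NavierStokesRegularity/NavierStokesRegularity/Theorems/SoloRefuteLindgren2012.lean`); the
`theorem`s are unfolding lemmas, the kernel COMPOSITION of the paper's own implications, and the Clay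
link.

Version of record: J. Lindgren, arXiv:1207.1090 **v3** [physics.gen-ph], 11 Feb 2014, «Navier-Stokes
regularity in 3D», TeX `pub/ns-claims/sources/Lindgren2012/arXiv-1207.1090v3-TeX_PINNED/teoriaNS.tex`
(173 lines; equations unnumbered in the source, numbered (1)–(28) by LaTeX in order — we cite TeX lines AND
those numbers), PDF + page texts `…/arXiv-PDFs/` (printed page = PDF page − 2; PAGEMAP.md by ns-claims-lit-1),
locators `sources/Lindgren2012/LOCATORS.md` (ns-claims-lit-3). Bib key `Lindgren2012`. (v1/v2, July/Aug 2012,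
are a DIFFERENT text — «backwards heat equation and renormalization» — superseded by v3 and not typed; the
companion arXiv:1206.1281 v3, bib `Lindgren2012b`, prescribes the pressure by a Poisson equation of the
author's choosing — a Δ2 candidate recorded on the CARD, not typed here.)

## Claimed statement (as printed)

Abstract (TeX l.24–28): «This short proof shows that for smooth and sufficiently fast decaying initial
data at infinity, the full incompressible Navier-Stokes solutions are eternal. The proof uses an orthogonal
decomposition of the velocity field and some well-known vector calculus identities to establish a
particular contradiction, which leads to a vanishing integral, which is the main integral that determines
the evolution of enstrophy. As it is shown that enstrophy is non-increasing, it is well-know that the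
solutions stay regular at all times.» Last lines (l.169–171, print p. 3): «(28) d/dt ∫_{ℝ³} ω·ω dx ≤ 0.
It is well known that if the total enstrophy stays bounded, the solutions stay regular. QED.»
Setting (l.30–50, print p. 1): NS on `ℝ³`, `f ≡ 0`, viscosity `ν` (written `1` in (1), `ν` from (4) on),
velocity «decays fast in infinity» (l.58). Typed: `ClaimedTheorem` — for every `ν > 0` and every datum of
the class (smooth, divergence-free, every derivative in `L²(ℝ³)`: the `H^∞ ∩ C^∞` rendering of «smooth and
sufficiently fast decaying», = C25 `Ruzmaikina2008.IsDatum`, containing all Clay data (4)), a global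
solution on `ℝ³ × [0,∞)` in the class (`Ruzmaikina2008.IsGlobalSolution`) exists.

## Clay delta (reference `ClayVariants.lean`)

Nearest: (A) = `ClayVariants.clayR3.Regularity`. Δ1 ℝ³ = · Δ2 NS = · Δ3 f ≡ 0 = · Δ4 data «smooth and
sufficiently fast decaying» ⊇ (4) = · Δ5 smooth; (7) follows in the class from the energy inequality ·
Δ6 global = · Δ7 all ν = . **`clay_of_claimed : ClaimedTheorem → clayR3.Regularity` is PROVED** (bridge
`isNavierStokesSolution_and_smooth_iff` + `IsClassicalNSSolutionOn.bkm_energy_le`, the C25/C30 argument):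
the claim as typed would decide Clay (A); no wrong-problem axis.

## Steps (paper item · print page · TeX lines · typist's private flag) — ordered index (HYGIENE 11)

All fields/solutions below are in the class (`IsDatum`, `IsSolutionOn ν a b` = classical on `[a,b]` with all
`L²` Sobolev norms bounded — so every printed integral is a Bochner integral of an integrable function; no
junk-value trap). `ω = curl u`, `c = ∇ × ω = curl (curl u)`, `u_∥ = (⟪u, c⟫/‖c‖²) c` (pointwise projection
on `c`; `0` where `c = 0`, the paper does not address that set), `u_⊥ = u − u_∥`, `E = ∫ |ω|²`.
* Step 1 = `Step1_EnstrophyIdentity` — §1.1 (6)–(9), l.53–73, print p. 1–2: `∫ ω·(∇×u) = ∫ u·(∇×ω)`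
  («assuming the velocity field decays fast in infinity») — plausible (integration by parts; support).
* Step 2 = `Step2_ParallelReduction` — (10)–(12), l.75–87, print p. 2: `E = ∫ u_∥·(∇×ω)` — plausible
  (pointwise `⟪u_⊥, c⟫ = 0`; support). The sentence l.95 «the time derivative of enstrophy does not depend
  on the velocity component which is perpendicular to ∇×ω» is the seed of Step 4 and is typed there.
* Step 3 = `Step3_EnstrophyEvolution` — (14)–(25), l.100–155, print p. 2–3: along a solution,
  `½ dE/dt = ∫ ω·((∇×ω)×u_⊥) + ν ∫ ω·Δω` — plausible (the standard enstrophy balance: `∫ ω·∇×(u×ω) =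
  ∫ (u×ω)·(∇×ω) = ∫ ω·((∇×ω)×u) = ∫ ω·((∇×ω)×u_⊥)`, (15)–(23)); differentiability of `E` in `t` within the
  time interval is part of the typed assertion.
* **Step 4 = `Step4_VanishingIntegral`** — (26), l.157–161, print p. 3: «Now it seems that the enstrophy
  here depends on the orthogonal part of the velocity field. This cannot be the case and is a clear
  contradiction, therefore it must be so that the integral involving the perpendicular part vanishes, so
  that ∫_{ℝ³} ω·((∇×ω)×u_⊥) dV = 0» — at every time of every solution in the class. LOAD-BEARING;
  SUSPICIOUS (the integral is the vortex-stretching / enstrophy-production term `∫ ω·(ω·∇)u`). Kinematic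
  twin (F15 grain, the grain the «contradiction» argument actually uses — it compares the shapes of (13) and
  (25) with no dynamics): `Step4_VanishingIntegral_kinematic` — the integral vanishes for EVERY field of
  the class; `step4_of_kinematic : kinematic → Step 4` PROVED (slices of solutions are in the class). The
  pointwise identity `ω·((∇×ω)×u_⊥) = ω·((∇×ω)×u)` ((21)–(23) backwards) is PROVED
  (`inner_cross_uPerp`), so a refuter may drop the projection: `stretchPerp v = ∫ ⟪ω, c × u⟫`
  (`stretchPerp_eq`).
* Step 5 = `Step5_EnstrophyBound` — (27)–(28), l.163–169, print p. 3 («the enstrophy differential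
  equation reduces to ½ dE/dt = ∫ ω·νΔω and noting that the integral is always non-positive, finally we
  have d/dt ∫ ω·ω ≤ 0») + the first half of l.171 («if the total enstrophy stays bounded»): if along a
  solution on `[0,T]` the derivative of `E` is `2ν ∫ ω·Δω` at every time, then `E(t) ≤ E(0)` on `[0,T]` —
  plausible/true (`∫ ω·Δω = −∫|∇ω|² ≤ 0` by parts + monotonicity from the sign of the derivative).
* Step 6 = `Step6_RegularityCriterion` — l.171, print p. 3: «It is well known that if the total enstrophy
  stays bounded, the solutions stay regular» — typed as the continuation statement the QED consumes: if for
  the datum `u₀` every solution on every `[0,T]` obeys `E(t) ≤ E(0)`, a global solution in the class exists —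
  classical (local existence in `H^∞` + `H¹` continuation; Majda–Bertozzi Thm 3.4/§3.2), TRUE; not a
  locator candidate.

## COMPOSITION — proved as `claim_of_steps`

`claim_of_steps : Step1 → Step2 → Step3 → Step4 → Step5 → Step6 → ClaimedTheorem` — PROVED (short logic):
for a datum `u₀` and a solution on `[0,T]`, Step 3 gives the derivative of `E`, Step 4 deletes the
stretching integral, Step 5 turns `½E′ = ν∫ω·Δω` into `E(t) ≤ E(0)`, and Step 6 returns the global
solution; Steps 1–2 are §1.1's preliminaries (carried in print order, underscored). The paper's logic
COMPOSES; the adjudication is about the truth of Step 4 (l.157–161, print p. 3), whose kinematic twin is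
refutable by ONE explicit field of the class with non-zero enstrophy production.

## Design / conventions

* Vocabulary REUSED from C25 `Literature.Claims.NS.Ruzmaikina2008` (same family «a-priori bound by
  identity», census §7; TYPER LINT: cite, do not restate): `IsDatum` (smooth ∧ div-free ∧ `H^∞`),
  `IsSolutionOn ν a b u p` (classical on `[a,b]`, `HasBoundedSobolevNormsOn`), `IsSolution ν T u₀ u p`,
  `IsGlobalSolution ν u₀ u p`, `isDatum_slice`; tree `curl`, `cross`, `Δ`, `IsClassicalNSSolutionOn`.
* `E3 = EuclideanSpace ℝ (Fin 3)`; integrals are Bochner integrals over `ℝ³` (integrable in the class).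
* No instance, no notation, no axiom, no sorry.

WHAT THIS IS NOT: not a claim about NS regularity or blow-up; not a claim about any author beyond the
typed locator.
-/

noncomputable section

open Set Function Filter MeasureTheory
open scoped Topology ENNReal NNReal ContDiff RealInnerProductSpace Laplacian InnerProductSpace

namespace Literature.Claims.NS.Lindgren2012

open Literature.Analysis.FluidPDE
open Literature.Claims.NS.Ruzmaikina2008 (IsDatum IsSolutionOn IsSolution IsGlobalSolution isDatum_slice)

/-! ## §A. Vocabulary (definitions with bodies; nothing asserted) -/

/-- Physical space `ℝ³`. [cite: Lindgren2012, §1 l.30 (print p. 1)] -/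
abbrev E3 : Type := EuclideanSpace ℝ (Fin 3)

/-- `∇ × ω = curl (curl v)`, the vector the decomposition (10) is taken along.
[cite: Lindgren2012, (7)–(10) l.60–78 (print p. 2)] -/
def ccurl (v : E3 → E3) (x : E3) : E3 :=
  curl (curl v) x

/-- `u_∥(x)` = the component of `u(x)` parallel to `(∇ × ω)(x)`: the orthogonal projection
`(⟪u, c⟫/‖c‖²) c`, `c = (∇×ω)(x)` (value `0` where `c = 0` — Lean's `x/0 = 0`; the paper does not discuss
the zero set of `∇×ω`). [cite: Lindgren2012, (10) l.75–78 (print p. 2)] -/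
def uPar (v : E3 → E3) (x : E3) : E3 :=
  (⟪v x, ccurl v x⟫ / ‖ccurl v x‖ ^ 2) • ccurl v x

/-- `u_⊥(x) = u(x) − u_∥(x)`, the component perpendicular to `(∇ × ω)(x)`.
[cite: Lindgren2012, (10) l.75–78 (print p. 2)] -/
def uPerp (v : E3 → E3) (x : E3) : E3 :=
  v x - uPar v x

/-- Enstrophy `E = ∫ ω·(∇×u) dV = ∫ |ω|² dV` ((8), «The left hand side is just the enstrophy of the
flow»). Bochner integral (integrable in the class). [cite: Lindgren2012, (8) l.63–67 (print p. 2)] -/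
def enstrophy (v : E3 → E3) : ℝ :=
  ∫ x, ‖curl v x‖ ^ 2

/-- The «integral involving the perpendicular part», `∫ ω·((∇×ω)×u_⊥) dV` (the integrand of (23)/(25),
asserted to vanish in (26)). [cite: Lindgren2012, (23)–(26) l.141–161 (print p. 3)] -/
def stretchPerp (v : E3 → E3) : ℝ :=
  ∫ x, ⟪curl v x, cross (ccurl v x) (uPerp v x)⟫

/-- The same integral without the projection, `∫ ω·((∇×ω)×u) dV` (= (21) integrated; equal to
`stretchPerp`, `stretchPerp_eq`; = `∫ (u×ω)·(∇×ω)` = the vortex-stretching integral `∫ ω·(ω·∇)u` after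
one integration by parts). [cite: Lindgren2012, (20)–(21) l.126–132 (print p. 3)] -/
def stretch (v : E3 → E3) : ℝ :=
  ∫ x, ⟪curl v x, cross (ccurl v x) (v x)⟫

/-- The viscous term `∫ ω·Δω dV` of (25)/(27) (sign: `= −∫|∇ω|²` after one integration by parts).
[cite: Lindgren2012, (25)–(27) l.155–165 (print p. 3)] -/
def dissip (v : E3 → E3) : ℝ :=
  ∫ x, ⟪curl v x, Δ (curl v) x⟫

/-! ### Pointwise algebra: the projection is invisible to `(∇×ω) × ·` -/

/-- `c × c = 0` for the tree's `cross` on `ℝ³` (Mathlib `cross_self`). [folklore] -/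
private theorem cross_self_eq_zero (c : E3) : cross c c = 0 := by
  simp [cross, cross_self]

/-- `(∇×ω) × u_⊥ = (∇×ω) × u` pointwise: the parallel component has zero cross product with `∇×ω`
(«Using the basic property of cross product», (22)–(23), read backwards).
[cite: Lindgren2012, (22)–(23) l.135–143 (print p. 3)] -/
theorem cross_ccurl_uPerp (v : E3 → E3) (x : E3) :
    cross (ccurl v x) (uPerp v x) = cross (ccurl v x) (v x) := by
  unfold uPerp uPar
  rw [← crossCLM_apply, map_sub, map_smul, crossCLM_apply, crossCLM_apply, cross_self_eq_zero,
    smul_zero, sub_zero]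

/-- `ω·((∇×ω)×u_⊥) = ω·((∇×ω)×u)` pointwise. [cite: Lindgren2012, (21)–(23) l.130–143 (print p. 3)] -/
theorem inner_cross_uPerp (v : E3 → E3) (x : E3) :
    ⟪curl v x, cross (ccurl v x) (uPerp v x)⟫ = ⟪curl v x, cross (ccurl v x) (v x)⟫ := by
  rw [cross_ccurl_uPerp]

/-- The «perpendicular» integral (26) is the plain integral `∫ ω·((∇×ω)×u)`.
[cite: Lindgren2012, (21)–(26) l.130–161 (print p. 3)] -/
theorem stretchPerp_eq (v : E3 → E3) : stretchPerp v = stretch v := by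
  unfold stretchPerp stretch
  exact integral_congr_ae (Eventually.of_forall fun x => inner_cross_uPerp v x)

/-! ## §B. The claimed statement -/

/-- **CLAIMED THEOREM** (abstract l.24–28; l.169–171 print p. 3): «for smooth and sufficiently fast
decaying initial data at infinity, the full incompressible Navier-Stokes solutions are eternal … the
solutions stay regular at all times» — for every `ν > 0` and every datum of the class a global solution on
`ℝ³ × [0,∞)` in the class exists. [cite: Lindgren2012, abstract l.24–28; l.169–171 (print p. 3)] -/
def ClaimedTheorem : Prop :=
  ∀ ν : ℝ, 0 < ν → ∀ u₀ : E3 → E3, IsDatum u₀ →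
    ∃ (u : ℝ → E3 → E3) (p : ℝ → E3 → ℝ), IsGlobalSolution ν u₀ u p

/-! ## §C. The steps -/

/-- **Step 1** — §1.1 «Enstrophy identity in ℝ³», (6)–(9), l.53–73 (print p. 1–2): «applying the
divergence theorem … assuming the velocity field decays fast in infinity, we have for the whole space
(7) ∫ ω·(∇×u) dV = ∫ u·(∇×ω) dV». For every field of the class. [cite: Lindgren2012, (6)–(9) l.53–73 (print p. 1–2)] -/
def Step1_EnstrophyIdentity : Prop :=
  ∀ v : E3 → E3, IsDatum v → ∫ x, ⟪curl v x, curl v x⟫ = ∫ x, ⟪v x, ccurl v x⟫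

/-- **Step 2** — (10)–(12), l.75–87 (print p. 2): «We can decompose the velocity field into two parts:
into one that is parallel to ∇×ω and into one which is perpendicular to it … By the defining property of
the dot product, we then have (12) E(t) = ∫ u_∥·(∇×ω) dV». [cite: Lindgren2012, (10)–(12) l.75–87 (print p. 2)] -/
def Step2_ParallelReduction : Prop :=
  ∀ v : E3 → E3, IsDatum v → enstrophy v = ∫ x, ⟪uPar v x, ccurl v x⟫

/-- **Step 3** — §1.2, (14)–(25), l.100–155 (print p. 2–3): dotting the vorticity equation (5) with `ω`,
using (15) `∇·(A×B) = B·(∇×A) − A·(∇×B)` with `A = u×ω`, `B = ω`, the triple product (21) and the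
decomposition (22)–(23), and integrating («noting that the divergence term vanishes»): (25)
`½ dE(t)/dt = ∫ ω·((∇×ω)×u_⊥) dV + ∫ ω·νΔω dV`. Typed along every solution of the class on every `[0,T]`
(derivative of `E` within `[0,T]`). [cite: Lindgren2012, (14)–(25) l.100–155 (print p. 2–3)] -/
def Step3_EnstrophyEvolution : Prop :=
  ∀ (ν T : ℝ) (u : ℝ → E3 → E3) (p : ℝ → E3 → ℝ), 0 < ν → 0 < T → IsSolutionOn ν 0 T u p →
    ∀ t ∈ Icc 0 T,
      HasDerivWithinAt (fun s => enstrophy (u s))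
        (2 * (stretchPerp (u t) + ν * dissip (u t))) (Icc 0 T) t

/-- **Step 4 — LOAD-BEARING** — (26), l.157–161 (print p. 3): «Now it seems that the enstrophy here
depends on the orthogonal part of the velocity field. This cannot be the case and is a clear
contradiction, therefore it must be so that the integral involving the perpendicular part vanishes, so
that (26) ∫_{ℝ³} ω·((∇×ω)×u_⊥) dV = 0.» At every time of every solution of the class on every `[0,T]`.
[cite: Lindgren2012, (26) l.157–161 (print p. 3)] -/
def Step4_VanishingIntegral : Prop :=
  ∀ (ν T : ℝ) (u : ℝ → E3 → E3) (p : ℝ → E3 → ℝ), 0 < ν → 0 < T → IsSolutionOn ν 0 T u p →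
    ∀ t ∈ Icc 0 T, stretchPerp (u t) = 0

/-- **Step 4, kinematic twin** (F15 grain — the «contradiction» compares the shapes of (13) and (25) and
invokes no dynamics): (26) for EVERY field of the class, `∫ ω·((∇×ω)×u_⊥) dV = 0`. Implies Step 4
(`step4_of_kinematic`). [cite: Lindgren2012, (26) l.157–161 with (13) l.91–95 (print p. 2–3)] -/
def Step4_VanishingIntegral_kinematic : Prop :=
  ∀ v : E3 → E3, IsDatum v → stretchPerp v = 0

/-- **Step 5** — (27)–(28), l.163–169 (print p. 3): «This means that the enstrophy differential equation
reduces to (27) ½ dE(t)/dt = ∫ ω·νΔω dV and noting that the integral is always non-positive, finally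
we have (28) d/dt ∫ ω·ω dx ≤ 0» + l.171 «if the total enstrophy stays bounded»: along a solution on
`[0,T]` whose enstrophy has derivative `2ν ∫ ω·Δω` within `[0,T]` at every time, `E(t) ≤ E(0)` on `[0,T]`.
(True: `∫ ω·Δω = −∫|∇ω|² ≤ 0` in the class, and a function with non-positive derivative does not
increase.) [cite: Lindgren2012, (27)–(28) l.163–171 (print p. 3)] -/
def Step5_EnstrophyBound : Prop :=
  ∀ (ν T : ℝ) (u : ℝ → E3 → E3) (p : ℝ → E3 → ℝ), 0 < ν → 0 < T → IsSolutionOn ν 0 T u p →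
    (∀ t ∈ Icc 0 T,
      HasDerivWithinAt (fun s => enstrophy (u s)) (2 * (ν * dissip (u t))) (Icc 0 T) t) →
    ∀ t ∈ Icc 0 T, enstrophy (u t) ≤ enstrophy (u 0)

/-- **Step 6** — l.171 (print p. 3): «It is well known that if the total enstrophy stays bounded, the
solutions stay regular. QED.» Typed as the continuation statement consumed: for `ν > 0` and a datum `u₀`
of the class, if EVERY solution on EVERY `[0,T]` with `u(0) = u₀` satisfies `E(t) ≤ E(0)` on `[0,T]`,
then a global solution in the class exists (local existence in `H^∞` + the `H¹` continuation criterion).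
Classical. [cite: Lindgren2012, l.171 (print p. 3)] -/
def Step6_RegularityCriterion : Prop :=
  ∀ ν : ℝ, 0 < ν → ∀ u₀ : E3 → E3, IsDatum u₀ →
    (∀ T : ℝ, 0 < T → ∀ (u : ℝ → E3 → E3) (p : ℝ → E3 → ℝ), IsSolution ν T u₀ u p →
      ∀ t ∈ Icc 0 T, enstrophy (u t) ≤ enstrophy u₀) →
    ∃ (u : ℝ → E3 → E3) (p : ℝ → E3 → ℝ), IsGlobalSolution ν u₀ u p

/-! ## §D. Compositions (kernel) -/

/-- The kinematic twin implies Step 4 (time slices of solutions of the class are fields of the class,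
`Ruzmaikina2008.isDatum_slice`). [cite: Lindgren2012, (26) l.157–161 (print p. 3)] -/
theorem step4_of_kinematic (h : Step4_VanishingIntegral_kinematic) : Step4_VanishingIntegral :=
  fun _ν _T u _p _hν _hT hsol t ht => h (u t) (isDatum_slice hsol ht)

/-- **COMPOSITION** `Step 1 → … → Step 6 → ClaimedTheorem` — PROVED. For a datum `u₀` and any
solution on `[0,T]` from it: Step 3 (derivative of `E`), Step 4 (the stretching integral is `0`), Step 5
(`E(t) ≤ E(0)`); Step 6 then yields the global solution. Steps 1–2 (§1.1) are carried in print order.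
[cite: Lindgren2012, §1 l.30–171 (print p. 1–3)] -/
theorem claim_of_steps (_h1 : Step1_EnstrophyIdentity) (_h2 : Step2_ParallelReduction)
    (h3 : Step3_EnstrophyEvolution) (h4 : Step4_VanishingIntegral) (h5 : Step5_EnstrophyBound)
    (h6 : Step6_RegularityCriterion) : ClaimedTheorem := by
  intro ν hν u₀ hu₀
  refine h6 ν hν u₀ hu₀ fun T hT u p hsol t ht => ?_
  have hsolOn : IsSolutionOn ν 0 T u p := hsol.sol
  have hder : ∀ s ∈ Icc 0 T,
      HasDerivWithinAt (fun τ => enstrophy (u τ)) (2 * (ν * dissip (u s))) (Icc 0 T) s := by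
    intro s hs
    have h := h3 ν T u p hν hT hsolOn s hs
    rwa [h4 ν T u p hν hT hsolOn s hs, zero_add] at h
  have hle := h5 ν T u p hν hT hsolOn hder t ht
  rwa [hsol.initial] at hle

/-! ## §E. The Clay link — PROVED (no delta) -/

/-- In the class, the lower and the Bochner energy integrals of a slice agree (plumbing, as in C25/C30).
[cite: FeffermanClay2006, statement (A) (7)] -/
private theorem lintegral_energy_eq {ν : ℝ} {u₀ : E3 → E3} {u : ℝ → E3 → E3} {p : ℝ → E3 → ℝ}
    (hsol : IsGlobalSolution ν u₀ u p) {S : ℝ} (hS : 0 < S) {τ : ℝ} (hτ : τ ∈ Icc (0:ℝ) S) :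
    ∫⁻ x, ‖u τ x‖ₑ ^ 2 = ENNReal.ofReal (∫ x, ‖u τ x‖ ^ 2) := by
  have hcl : IsClassicalNSSolutionOn (Icc 0 S) ν 0 u p :=
    hsol.isClassical.mono Icc_subset_Ici_self (uniqueDiffOn_Icc hS)
  obtain ⟨C, hC⟩ := hsol.sobolev S 0
  have hfin0 : ∫⁻ x, ‖iteratedFDeriv ℝ 0 (u τ) x‖ₑ ^ 2 < ⊤ := (hC τ hτ).trans_lt ENNReal.coe_lt_top
  have heq : (fun x => ‖iteratedFDeriv ℝ 0 (u τ) x‖ₑ ^ 2) = fun x => ‖u τ x‖ₑ ^ 2 := by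
    funext x
    rw [← ofReal_norm, norm_iteratedFDeriv_zero, ofReal_norm]
  have hfin : ∫⁻ x, ‖u τ x‖ₑ ^ 2 < ⊤ := by rwa [heq] at hfin0
  have hint : Integrable (fun x => ‖u τ x‖ ^ 2) :=
    integrable_sq_norm_of_lintegral_lt_top (hcl.contDiff_velocity hτ).continuous hfin
  rw [ofReal_integral_eq_lintegral_ofReal hint (Eventually.of_forall fun x => sq_nonneg _)]
  refine lintegral_congr fun x => ?_
  rw [← ofReal_norm, ENNReal.ofReal_pow (norm_nonneg _)]

/-- **`ClaimedTheorem → clayR3.Regularity`** (Clay (A) via `ClayVariants`, token-for-token the summit body):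
a Clay datum is a datum of the class (Schwartz ⇒ `H^∞`, tree
`HasRapidSpatialDecay.lintegral_enorm_iteratedFDeriv_sq_lt_top`); the global solution of the class is
smooth on `ℝ³ × [0,∞)` with `u(0) = u₀` (bridge `isNavierStokesSolution_and_smooth_iff`), and (7) holds
with `C = ∫|u₀|²` by the energy inequality in the BKM class (`IsClassicalNSSolutionOn.bkm_energy_le`) —
the argument of C25 `Ruzmaikina2008.clay_of_claimed_of_delta` without its horizon delta. HYGIENE 10(a):
the claim as typed would decide Clay (A). [cite: FeffermanClay2006, statement (A), CMI offprint p. 2] -/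
theorem clay_of_claimed (h : ClaimedTheorem) : ClayVariants.clayR3.Regularity := by
  intro ν hν u₀ hu₀ hdiv hdecay
  have hdat : IsDatum u₀ :=
    ⟨hu₀, fun x => hdiv x, fun n => hdecay.lintegral_enorm_iteratedFDeriv_sq_lt_top n⟩
  obtain ⟨u, p, hsol⟩ := h ν hν u₀ hdat
  obtain ⟨hns, hsu, hsp⟩ :=
    (isNavierStokesSolution_and_smooth_iff (ν := ν) (f := 0) (u₀ := u₀) (u := u) (p := p)).2
      ⟨hsol.isClassical, hsol.initial⟩
  refine ⟨u, p, hsu, hsp, hns, ?_⟩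
  show HasBoundedEnergy u
  refine ⟨∫⁻ x, ‖u₀ x‖ₑ ^ 2, ?_, fun t ht => ?_⟩
  · have h0 := hdat.2.2 0
    have heq : (fun x => ‖iteratedFDeriv ℝ 0 u₀ x‖ₑ ^ 2) = fun x => ‖u₀ x‖ₑ ^ 2 := by
      funext x
      rw [← ofReal_norm, norm_iteratedFDeriv_zero, ofReal_norm]
    rwa [heq] at h0
  · have hT : (0:ℝ) < t + 1 := by linarith
    have hcl : IsClassicalNSSolutionOn (Icc 0 (t + 1)) ν 0 u p :=
      hsol.isClassical.mono Icc_subset_Ici_self (uniqueDiffOn_Icc hT)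
    have hE : ∫ x, ‖u t x‖ ^ 2 ≤ ∫ x, ‖u 0 x‖ ^ 2 :=
      hcl.bkm_energy_le hν.le hT (hsol.sobolev (t + 1)) ⟨ht, by linarith⟩
    rw [lintegral_energy_eq hsol hT ⟨ht, by linarith⟩, ← hsol.initial,
      lintegral_energy_eq hsol hT ⟨le_rfl, hT.le⟩]
    exact ENNReal.ofReal_le_ofReal hE


/-! ## D-0026 in-file discharges — Steps 1, 2, 5, 6 (typist-9 g4, APPEND-ONLY)

Literature-side ports of the kernel proofs of ns-claims-salvage-p3 (g2/g3),
`Summits/…/Theorems/SoloSalvageLindgren2012.lean` (Steps 1, 2, 5: p484197 / p485039) and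
`Summits/…/Theorems/SoloSalvageLindgren2012Global.lean` (Step 6), which Literature cannot import.
In the rendered `H^∞ ∩ C^∞` class `Ruzmaikina2008.IsDatum`: (7) the curl is `L²`-self-adjoint
(Step 1), (12) the parallel reduction (Step 2), (27)–(28) enstrophy non-increase GIVEN the evolution
law (Step 5; the viscous pairing `∫⟪ω, Δω⟫ = −∫|∇ω|²_F ≤ 0`), and the enstrophy door l.171 p. 3
(Step 6 = tree `exists_global_classical_of_apriori_enstrophy_bound`). Step 3 (the enstrophy
evolution (14)–(25), kernel Summits-side in `SoloSalvageLindgren2012Enstrophy.lean` p497937) is not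
ported here; Step 4 ((26), the vortex-stretching integral asserted to vanish) is the adjudicated
locator, kernel-false Summits-side (`…Theorems.Lindgren2012.not_Step4_VanishingIntegral_kinematic`).
No statement / def / locator / class above is touched; nine imports are added for the ported proofs.

WHAT THIS IS NOT: not a claim about NS regularity or blow-up; not a claim about any author beyond
the typed locator. -/

/-- In the class, `u`, `ω = ∇×u` and `∇×ω` are square integrable (orders `0, 1, 2` of the `H^∞`
hypothesis; `‖∇×v‖ ≤ κ‖Dv‖`, `‖D(∇×v)‖ ≤ κ‖D²v‖`). [cite: Lindgren2012, (6)–(9) l.53–73 (print p. 1–2): the class of (7)] -/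
theorem integrable_sq_norms {v : EuclideanSpace ℝ (Fin 3) → EuclideanSpace ℝ (Fin 3)} (hv : IsDatum v) :
    Integrable (fun x => ‖v x‖ ^ 2) ∧ Integrable (fun x => ‖curl v x‖ ^ 2) ∧
      Integrable (fun x => ‖ccurl v x‖ ^ 2) := by
  obtain ⟨hsmooth, -, hsob⟩ := hv
  have h0 : Integrable (fun x => ‖v x‖ ^ 2) := by
    have h := integrable_sq_norm_of_lintegral_lt_top
      (hsmooth.continuous_iteratedFDeriv (m := 0) (by simp)) (hsob 0)
    refine h.congr (Filter.Eventually.of_forall fun x => ?_)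
    simp only [norm_iteratedFDeriv_zero]
  have h1 : Integrable (fun x => ‖curl v x‖ ^ 2) :=
    (integrable_norm_curl_sq (hsmooth.of_le (by norm_cast)) (hsob 1)).1
  -- `‖∇×(∇×v)‖ ≤ κ ‖D(∇×v)‖ ≤ κ² ‖D²v‖`
  have hv2 : ContDiff ℝ 2 v := hsmooth.of_le (by norm_cast)
  have hD2c : Continuous (iteratedFDeriv ℝ 2 v) := hsmooth.continuous_iteratedFDeriv (by norm_cast)
  have hD2 : Integrable fun x => ‖iteratedFDeriv ℝ 2 v x‖ ^ 2 :=
    integrable_sq_norm_of_lintegral_lt_top hD2c (hsob 2)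
  have hcc : Continuous (ccurl v) := by
    have h := contDiff_curl (n := 1) (v := curl v)
      (by exact_mod_cast (contDiff_curl (n := 2) (by exact_mod_cast (hsmooth.of_le (by norm_cast) : ContDiff ℝ 3 v))))
    exact h.continuous
  have hpt : ∀ x, ‖ccurl v x‖ ^ 2 ≤ (‖curlCLM‖ ^ 2) ^ 2 * ‖iteratedFDeriv ℝ 2 v x‖ ^ 2 := by
    intro x
    have h1' : ‖ccurl v x‖ ≤ ‖curlCLM‖ * ‖fderiv ℝ (curl v) x‖ := norm_curl_le (curl v) x
    have h2' : ‖fderiv ℝ (curl v) x‖ ≤ ‖curlCLM‖ * ‖iteratedFDeriv ℝ 2 v x‖ := norm_fderiv_curl_le hv2 x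
    have h3 : ‖ccurl v x‖ ≤ ‖curlCLM‖ ^ 2 * ‖iteratedFDeriv ℝ 2 v x‖ := by
      calc ‖ccurl v x‖ ≤ ‖curlCLM‖ * (‖curlCLM‖ * ‖iteratedFDeriv ℝ 2 v x‖) :=
            h1'.trans (mul_le_mul_of_nonneg_left h2' (norm_nonneg curlCLM))
        _ = ‖curlCLM‖ ^ 2 * ‖iteratedFDeriv ℝ 2 v x‖ := by ring
    calc ‖ccurl v x‖ ^ 2 ≤ (‖curlCLM‖ ^ 2 * ‖iteratedFDeriv ℝ 2 v x‖) ^ 2 :=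
          pow_le_pow_left₀ (norm_nonneg _) h3 2
      _ = (‖curlCLM‖ ^ 2) ^ 2 * ‖iteratedFDeriv ℝ 2 v x‖ ^ 2 := by ring
  have h2 : Integrable (fun x => ‖ccurl v x‖ ^ 2) :=
    (hD2.const_mul _).mono' (hcc.norm.pow 2).aestronglyMeasurable
      (Filter.Eventually.of_forall fun x => by
        rw [Real.norm_eq_abs, abs_of_nonneg (sq_nonneg _)]; exact hpt x)
  exact ⟨h0, h1, h2⟩

/-- **Step 1 — the enstrophy identity (7) holds in the class** (port of the Summits-side
`…Theorems.Lindgren2012Salvage.lindgren2012_step1_holds`, salvage-p3, p484197): `∫ ⟪∇×u, ∇×u⟫ = ∫ ⟪u, ∇×(∇×u)⟫` for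
every `u ∈ IsDatum` (the curl is self-adjoint on `L²`-integrable pairs; Majda–Bertozzi 2002 §1.7; tree
`FarhatGrujic2018.integral_inner_curl_eq_integral_inner_curl_of_integrable`).
[cite: Lindgren2012, (6)–(9) l.53–73 (print p. 1–2)] [cite: MajdaBertozzi2002, §1.7] -/
theorem step1_holds : Step1_EnstrophyIdentity := by
  intro v hv
  obtain ⟨h0, h1, h2⟩ := integrable_sq_norms hv
  have hsmooth : ContDiff ℝ ∞ v := hv.1
  have hv1 : ContDiff ℝ 1 v := hsmooth.of_le (by norm_cast)
  have hω1 : ContDiff ℝ 1 (curl v) :=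
    contDiff_curl (n := 1) (by exact_mod_cast (hsmooth.of_le (by norm_cast) : ContDiff ℝ 2 v))
  have hvc : Continuous v := hv1.continuous
  have hωc : Continuous (curl v) := hω1.continuous
  have hcc : Continuous (ccurl v) := by
    have h := contDiff_curl (n := 1) (v := curl v)
      (by exact_mod_cast (contDiff_curl (n := 2) (by exact_mod_cast (hsmooth.of_le (by norm_cast) : ContDiff ℝ 3 v))))
    exact h.continuous
  -- `ω × u ∈ L¹`
  have hX : Integrable fun y => cross (curl v y) (v y) := by
    refine Integrable.mono' ((h1.add h0).div_const 2)
      ((crossCLM.continuous₂.comp₂ hωc hvc).aestronglyMeasurable) (Filter.Eventually.of_forall fun y => ?_)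
    calc ‖cross (curl v y) (v y)‖ ≤ ‖curl v y‖ * ‖v y‖ := norm_cross_le_norm_mul_norm _ _
      _ ≤ (‖curl v y‖ ^ 2 + ‖v y‖ ^ 2) / 2 := by nlinarith [sq_nonneg (‖curl v y‖ - ‖v y‖)]
  -- `⟪u, ∇×ω⟫ ∈ L¹`
  have hI1 : Integrable fun y => ⟪v y, curl (curl v) y⟫ := by
    refine Integrable.mono' ((h0.add h2).div_const 2)
      ((hvc.inner hcc).aestronglyMeasurable) (Filter.Eventually.of_forall fun y => ?_)
    calc ‖⟪v y, curl (curl v) y⟫‖ ≤ ‖v y‖ * ‖ccurl v y‖ := norm_inner_le_norm _ _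
      _ ≤ (‖v y‖ ^ 2 + ‖ccurl v y‖ ^ 2) / 2 := by nlinarith [sq_nonneg (‖v y‖ - ‖ccurl v y‖)]
  -- `⟪ω, ω⟫ ∈ L¹`
  have hI2 : Integrable fun y => ⟪curl v y, curl v y⟫ :=
    h1.congr (Filter.Eventually.of_forall fun y => (real_inner_self_eq_norm_sq _).symm)
  exact FarhatGrujic2018.integral_inner_curl_eq_integral_inner_curl_of_integrable hv1 hω1 hX hI1 hI2

/-- Pointwise, the projection onto `c = ∇×ω` is invisible to the pairing with `c`:
`⟪u_∥(x), c(x)⟫ = ⟪u(x), c(x)⟫` (on the zero set of `c` both sides vanish).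
[cite: Lindgren2012, (10)–(12) l.75–87 (print p. 2)] -/
theorem inner_uPar_ccurl (v : EuclideanSpace ℝ (Fin 3) → EuclideanSpace ℝ (Fin 3))
    (x : EuclideanSpace ℝ (Fin 3)) : ⟪uPar v x, ccurl v x⟫ = ⟪v x, ccurl v x⟫ := by
  unfold uPar
  rw [real_inner_smul_left, real_inner_self_eq_norm_sq]
  by_cases hc : ‖ccurl v x‖ = 0
  · have hc' : ccurl v x = 0 := norm_eq_zero.1 hc
    simp [hc']
  · field_simp

/-- **Step 2 — the parallel reduction (12) holds in the class** (port of
`…Theorems.Lindgren2012Salvage.lindgren2012_step2_holds`, salvage-p3): `E = ∫ |ω|² = ∫ ⟪u_∥, ∇×ω⟫` (pointwise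
`⟪u_∥, ∇×ω⟫ = ⟪u, ∇×ω⟫`, then the enstrophy identity of Step 1).
[cite: Lindgren2012, (10)–(12) l.75–87 (print p. 2)] -/
theorem step2_holds : Step2_ParallelReduction := by
  intro v hv
  unfold enstrophy
  have h1 := step1_holds v hv
  simp_rw [inner_uPar_ccurl]
  rw [← integral_congr_ae (Filter.Eventually.of_forall fun x => real_inner_self_eq_norm_sq (curl v x))]
  exact h1

/-! ### The viscous pairing is non-positive in the class; Step 5 -/

/-- **`∫ ⟪ω, Δω⟫ ≤ 0` in the class** (`ω = ∇×v`, `v ∈ IsDatum`): with `φ = |ω|²`,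
`div (∇φ) = Δφ = 2⟪Δω, ω⟫ + 2|∇ω|²_F` (`laplacian_inner_self_eq`) and `∫ div(∇φ) = 0`, the gradient
`∇φ = 2⟪ω, Dω·⟫` and its divergence being integrable by the `L²` bounds on `ω, ∇ω, ∇²ω` of the class;
hence `∫⟪ω, Δω⟫ = −∫|∇ω|²_F ≤ 0`. [cite: Lindgren2012, (27)–(28) l.163–171 (print p. 3)] -/
theorem dissip_nonpos {v : EuclideanSpace ℝ (Fin 3) → EuclideanSpace ℝ (Fin 3)} (hv : IsDatum v) :
    dissip v ≤ 0 := by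
  obtain ⟨h0, h1, h2⟩ := integrable_sq_norms hv
  obtain ⟨hsmooth, -, hsob⟩ := hv
  set w : EuclideanSpace ℝ (Fin 3) → EuclideanSpace ℝ (Fin 3) := curl v with hw
  have hw2 : ContDiff ℝ 2 w :=
    contDiff_curl (n := 2) (by exact_mod_cast (hsmooth.of_le (by norm_cast) : ContDiff ℝ 3 v))
  have hw1 : ContDiff ℝ 1 w := hw2.of_le (by norm_cast)
  have hwc : Continuous w := hw1.continuous
  have hDwc : Continuous (fderiv ℝ w) := hw1.continuous_fderiv one_ne_zero
  -- `L²` bounds of the class for `ω`, `∇ω`, `Δω`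
  have hv3 : ContDiff ℝ 3 v := hsmooth.of_le (by norm_cast)
  have hFrob : Integrable fun x => frobeniusNormSq (fderiv ℝ w x) :=
    (integrable_frobeniusNormSq_fderiv_curl hv3 (hsob 2)).1
  have hDw_sq : Integrable fun x => ‖fderiv ℝ w x‖ ^ 2 :=
    hFrob.mono' (hDwc.norm.pow 2).aestronglyMeasurable (Filter.Eventually.of_forall fun x => by
      rw [Real.norm_eq_abs, abs_of_nonneg (sq_nonneg _)]; exact sq_opNorm_le_frobeniusNormSq _)
  have hD3c : Continuous (iteratedFDeriv ℝ 3 v) := hsmooth.continuous_iteratedFDeriv (by norm_cast)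
  have hD3 : Integrable fun x => ‖iteratedFDeriv ℝ 3 v x‖ ^ 2 :=
    integrable_sq_norm_of_lintegral_lt_top hD3c (hsob 3)
  have hΔc : Continuous (Δ w) := continuous_laplacian hw2
  have hΔpt : ∀ x, ‖(Δ w) x‖ ≤ 3 * ‖curlCLM‖ * ‖iteratedFDeriv ℝ 3 v x‖ := by
    intro x
    have e1 : ‖fderiv ℝ (fderiv ℝ w) x‖ = ‖iteratedFDeriv ℝ 2 w x‖ := by
      rw [← norm_iteratedFDeriv_one (𝕜 := ℝ) (fderiv ℝ w), norm_iteratedFDeriv_fderiv]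
    have h3 : ‖iteratedFDeriv ℝ 2 w x‖ ≤ ‖curlCLM‖ * ‖iteratedFDeriv ℝ 3 v x‖ :=
      norm_iteratedFDeriv_curl_le_opNorm_mul (N := ⊤) hsmooth 2 le_top x
    calc ‖(Δ w) x‖ ≤ Module.finrank ℝ (EuclideanSpace ℝ (Fin 3)) * ‖fderiv ℝ (fderiv ℝ w) x‖ :=
          norm_laplacian_le w x
      _ = 3 * ‖iteratedFDeriv ℝ 2 w x‖ := by rw [finrank_euclideanSpace_fin, e1]; norm_num
      _ ≤ 3 * (‖curlCLM‖ * ‖iteratedFDeriv ℝ 3 v x‖) := by gcongr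
      _ = 3 * ‖curlCLM‖ * ‖iteratedFDeriv ℝ 3 v x‖ := by ring
  have hΔ_sq : Integrable fun x => ‖(Δ w) x‖ ^ 2 :=
    (hD3.const_mul ((3 * ‖curlCLM‖) ^ 2)).mono' (hΔc.norm.pow 2).aestronglyMeasurable
      (Filter.Eventually.of_forall fun x => by
        rw [Real.norm_eq_abs, abs_of_nonneg (sq_nonneg _)]
        calc ‖(Δ w) x‖ ^ 2 ≤ (3 * ‖curlCLM‖ * ‖iteratedFDeriv ℝ 3 v x‖) ^ 2 :=
              pow_le_pow_left₀ (norm_nonneg _) (hΔpt x) 2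
          _ = (3 * ‖curlCLM‖) ^ 2 * ‖iteratedFDeriv ℝ 3 v x‖ ^ 2 := by ring)
  -- the pairing `⟪Δω, ω⟫` is integrable
  have hpair : Integrable fun x => ⟪(Δ w) x, w x⟫ := by
    refine Integrable.mono' ((hΔ_sq.add h1).div_const 2) ((hΔc.inner hwc).aestronglyMeasurable)
      (Filter.Eventually.of_forall fun x => ?_)
    have hab : ‖(Δ w) x‖ * ‖w x‖ ≤ (‖(Δ w) x‖ ^ 2 + ‖w x‖ ^ 2) / 2 := by
      nlinarith [sq_nonneg (‖(Δ w) x‖ - ‖w x‖)]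
    exact (norm_inner_le_norm _ _).trans hab
  -- the field `F = ∇|ω|²` and its divergence
  set φ : EuclideanSpace ℝ (Fin 3) → ℝ := fun y => ⟪w y, w y⟫ with hφ
  have hφ2 : ContDiff ℝ 2 φ := (hw2.inner ℝ hw2)
  have hF1 : ContDiff ℝ 1 (gradient φ) :=
    (InnerProductSpace.toDual ℝ (EuclideanSpace ℝ (Fin 3))).symm.contDiff.comp
      (hφ2.fderiv_right (m := 1) le_rfl)
  have hFnorm : ∀ x, ‖gradient φ x‖ ≤ 2 * (‖w x‖ * ‖fderiv ℝ w x‖) := by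
    intro x
    have hdx : DifferentiableAt ℝ w x := (hw1.differentiable one_ne_zero) x
    have e : ‖gradient φ x‖ = ‖fderiv ℝ φ x‖ := by
      rw [gradient]; exact (InnerProductSpace.toDual ℝ _).symm.norm_map _
    rw [e]
    refine ContinuousLinearMap.opNorm_le_bound _ (by positivity) fun y => ?_
    rw [hφ, fderiv_inner_apply ℝ hdx hdx y]
    calc ‖⟪w x, fderiv ℝ w x y⟫ + ⟪fderiv ℝ w x y, w x⟫‖
        ≤ ‖⟪w x, fderiv ℝ w x y⟫‖ + ‖⟪fderiv ℝ w x y, w x⟫‖ := norm_add_le _ _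
      _ ≤ ‖w x‖ * ‖fderiv ℝ w x y‖ + ‖fderiv ℝ w x y‖ * ‖w x‖ :=
          add_le_add (norm_inner_le_norm _ _) (norm_inner_le_norm _ _)
      _ ≤ ‖w x‖ * (‖fderiv ℝ w x‖ * ‖y‖) + ‖fderiv ℝ w x‖ * ‖y‖ * ‖w x‖ := by
          gcongr <;> exact ContinuousLinearMap.le_opNorm _ _
      _ = 2 * (‖w x‖ * ‖fderiv ℝ w x‖) * ‖y‖ := by ring
  have hFint : Integrable (gradient φ) := by
    refine Integrable.mono' ((h1.add hDw_sq)) hF1.continuous.aestronglyMeasurable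
      (Filter.Eventually.of_forall fun x => ?_)
    have hab : 2 * (‖w x‖ * ‖fderiv ℝ w x‖) ≤ ‖w x‖ ^ 2 + ‖fderiv ℝ w x‖ ^ 2 := by
      nlinarith [sq_nonneg (‖w x‖ - ‖fderiv ℝ w x‖)]
    exact (hFnorm x).trans hab
  have hdiv_eq : ∀ x, VectorCalculus.divergence (gradient φ) x =
      2 * ⟪(Δ w) x, w x⟫ + 2 * frobeniusNormSq (fderiv ℝ w x) := fun x => by
    rw [divergence_gradient hφ2 x, hφ, laplacian_inner_self_eq hw2 x]
  have hdiv_int : Integrable fun x => VectorCalculus.divergence (gradient φ) x := by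
    have : (fun x => VectorCalculus.divergence (gradient φ) x) =
        fun x => 2 * ⟪(Δ w) x, w x⟫ + 2 * frobeniusNormSq (fderiv ℝ w x) := funext hdiv_eq
    rw [this]
    exact (hpair.const_mul 2).add (hFrob.const_mul 2)
  have h0int := PineauVicol2026.integral_divergence_eq_zero_of_integrable hF1 hFint hdiv_int
  simp_rw [hdiv_eq] at h0int
  rw [integral_add (hpair.const_mul 2) (hFrob.const_mul 2), integral_const_mul, integral_const_mul]
    at h0int
  -- `∫⟪ω, Δω⟫ = ∫⟪Δω, ω⟫ = −∫|∇ω|² ≤ 0`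
  have hsymm : dissip v = ∫ x, ⟪(Δ w) x, w x⟫ := by
    unfold dissip
    exact integral_congr_ae (Filter.Eventually.of_forall fun x => real_inner_comm _ _)
  have hFrob0 : 0 ≤ ∫ x, frobeniusNormSq (fderiv ℝ w x) :=
    integral_nonneg fun x => frobeniusNormSq_nonneg _
  rw [hsymm]
  linarith

/-- **Step 5 — (27)–(28) + «if the total enstrophy stays bounded» holds in the class** (port of
`…Theorems.Lindgren2012Salvage.lindgren2012_step5_holds`, salvage-p3 rev 2, p485039): along a solution
on `[0,T]` whose enstrophy has derivative `2ν∫⟪ω, Δω⟫` within `[0,T]` at every time, `E(t) ≤ E(0)` on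
`[0,T]` (the derivative is `≤ 0` by `dissip_nonpos` and `ν > 0`; a function with non-positive derivative
on an interval does not increase, Mathlib `antitoneOn_of_hasDerivWithinAt_nonpos`).
[cite: Lindgren2012, (27)–(28) l.163–171 (print p. 3)] -/
theorem step5_holds : Step5_EnstrophyBound := by
  intro ν T u p hν hT hsol hderiv t ht
  have hcont : ContinuousOn (fun s => enstrophy (u s)) (Icc 0 T) :=
    fun s hs => (hderiv s hs).continuousWithinAt
  have hanti : AntitoneOn (fun s => enstrophy (u s)) (Icc 0 T) := by
    refine antitoneOn_of_hasDerivWithinAt_nonpos (convex_Icc 0 T) hcont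
      (f' := fun s => 2 * (ν * dissip (u s))) (fun s hs => ?_) (fun s hs => ?_)
    · rw [interior_Icc] at hs ⊢
      exact (hderiv s (Ioo_subset_Icc_self hs)).mono Ioo_subset_Icc_self
    · rw [interior_Icc] at hs
      have hd : dissip (u s) ≤ 0 := dissip_nonpos (isDatum_slice hsol (Ioo_subset_Icc_self hs))
      nlinarith
  exact hanti ⟨le_rfl, hT.le⟩ ht ht.1

/-! ### Step 6 — the enstrophy door -/

/-- **The enstrophy door on `ℝ³`, claim-side rendering.** Let `ν > 0` and let `u₀` be a datum of the
class (`IsDatum`: smooth, divergence free, every derivative in `L²`). If there is `M` such that every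
solution of the class from `u₀` on a closed slab `[0,T]` (`IsSolution ν T u₀ u p`, `T > 0`) satisfies
`∫ |curl u(t)|² ≤ M` for all `t ∈ [0,T]`, then a global solution in the class exists
(`IsGlobalSolution`: classical on `[0,∞) × ℝ³`, `u(0) = u₀`, all Sobolev norms bounded on every
`[0,T]`). Unpacking of `exists_global_classical_of_apriori_enstrophy_bound`.
[cite: ConstantinFeffermanIndiana1993, §2 (end of proof)] [cite: MajdaBertozzi2002, Thm 3.6 and §3.2.3] -/
theorem exists_globalSolution_of_apriori_enstrophy_bound {ν : ℝ} (hν : 0 < ν)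
    {u₀ : EuclideanSpace ℝ (Fin 3) → EuclideanSpace ℝ (Fin 3)} (hu₀ : IsDatum u₀) {M : ℝ}
    (hM : ∀ T : ℝ, 0 < T → ∀ (u : ℝ → EuclideanSpace ℝ (Fin 3) → EuclideanSpace ℝ (Fin 3))
      (p : ℝ → EuclideanSpace ℝ (Fin 3) → ℝ), IsSolution ν T u₀ u p →
        ∀ t ∈ Icc 0 T, ∫ x, ‖curl (u t) x‖ ^ 2 ≤ M) :
    ∃ (u : ℝ → EuclideanSpace ℝ (Fin 3) → EuclideanSpace ℝ (Fin 3))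
      (p : ℝ → EuclideanSpace ℝ (Fin 3) → ℝ), IsGlobalSolution ν u₀ u p := by
  obtain ⟨hsm, hdiv, hH⟩ := hu₀
  obtain ⟨u, p, hcl, hu0, -, -, hsob⟩ :=
    exists_global_classical_of_apriori_enstrophy_bound hν hsm hdiv hH (M := M)
      fun T hT u p hcl hu0 hsob t ht => hM T hT u p ⟨⟨hcl, hsob⟩, hu0⟩ t ht
  exact ⟨u, p, hcl, hu0, hsob⟩

/-- **Step 6 of C32 is TRUE** (port of `…Theorems.Lindgren2012Salvage.lindgren2012_step6_holds`,
salvage-p3 g3, `SoloSalvageLindgren2012Global.lean`) — l.171 (print p. 3) «It is well known that if the total enstrophy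
stays bounded, the solutions stay regular. QED.», typed as `Step6_RegularityCriterion`: for `ν > 0`
and a datum `u₀` of the class, if every solution from `u₀` on every `[0,T]` obeys `E(t) ≤ E(u₀)`,
a global solution in the class exists. Instance `M = ∫|curl u₀|²` of
`exists_globalSolution_of_apriori_enstrophy_bound`. (The paper's use of it is moot: its hypothesis
is delivered through Step 4, the adjudicated locator.)
[cite: Lindgren2012, l.171 (print p. 3)] [cite: ConstantinFeffermanIndiana1993, §2 (end of proof)] -/
theorem step6_holds : Step6_RegularityCriterion := by
  intro ν hν u₀ hu₀ H
  exact exists_globalSolution_of_apriori_enstrophy_bound hν hu₀ (M := enstrophy u₀)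
    fun T hT u p hsol t ht => H T hT u p hsol t ht


end Literature.Claims.NS.Lindgren2012

end
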